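import Literature.NumberTheory.ComplexMultiplication.GaloisCMFieldsTwiceOddDegreePair
import Literature.AlgebraicGeometry.Pohlmann1968.WeilTypeCMSubfieldExceptionalClasses
import HarnessLib

/-!
# Two CM fields sharing an imaginary quadratic subfield: EVERY family of CM types is degenerate

Sequel of `NumberTheory/ComplexMultiplication/SharedImaginaryQuadraticDegenerate` (this seat), which proved that a
shared imaginary quadratic field `k` (embeddings `j₀ : k → K_{i₀}`, `j₁ : k → K_{i₁}`, `i₀ ≠ i₁`) makes the family
`(Φ_i)` degenerate as soon as BOTH `k`-signature defects `Σ_{φ ∈ Φ_{i_κ}} sign(φ|_k)` are non-zero.  This file removes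
that hypothesis: if the defect of `Φ_i` VANISHES then `Φ_i` is BALANCED over `k` — over each embedding of `k`, as many
extensions inside `Φ_i` as outside (`fibres_balanced_of_sum_ksign_eq_zero`) — hence `Φ_i` ITSELF is degenerate by
Yanai's theorem on types of Weil type (tree `Pohlmann1968.not_isNondegenerate_of_fibres_balanced`), and members of a
nondegenerate family are nondegenerate (Gordon 7.6.1, tree `CMAlgebra.IsNondegenerateFamily.isNondegenerate`).  Hence:

* **`not_isNondegenerateFamily_of_shared_imaginary_quadratic`** — `K_{i₀} ⊇ k ⊆ K_{i₁}` imaginary quadratic ⟹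
  `¬ IsNondegenerateFamily Φ` for EVERY family `Φ` of CM types, with no degree or signature hypothesis — on abelian
  varieties (`Summits/…/SharedImaginaryQuadraticCMFieldsHodge`): any two simple non-isogenous CM abelian varieties whose
  CM fields share an imaginary quadratic subfield carry an exceptional Hodge class on some `A₀^a × A₁^b`;
* `not_exists_partialConj_of_mem_inf_of_conj_ne` — no partial conjugation at a slot whose Galois closure meets another
  in a field moved by conjugation;
* the Galois-closure forms `not_isNondegenerateFamily_of_quadratic_le_inf'` (an imaginary quadratic `k ≤ L₀ ∩ L₁`) and
  the upgrade of the parity dichotomy of `GaloisCMFieldsTwiceOddDegreePair` to ONE field of degree `≡ 2 (mod 4)`: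
  **`not_isNondegenerateFamily_of_even_finrank_inf`** — `K_{i₁}` Galois CM of degree `2m₁`, `m₁` odd, `K_{i₀}` ANY
  Galois CM field, `[L₀ ∩ L₁ : ℚ]` even ⟹ every family degenerate — and
  **`forall_exists_partialConj_pair_or_not_isNondegenerateFamily_of_twice_odd'`** (odd ⟹ partial conjugations).

Everything is proved; no definition, no named fact, no `sorry`.

## References

* [Gordon1999HodgeAVSurvey] B. B. Gordon, *A survey of the Hodge conjecture for abelian varieties*, §3 Theorem (proof),
  7.5–7.7, 7.6.1, 9.4.3 (Theorem [B.140], Yanai).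
* [Deligne1982HodgeCycles] P. Deligne, *Hodge cycles on abelian varieties*, LNM 900 (1982), §4 (Weil classes).
* [Shimura1998] G. Shimura, *Abelian Varieties with Complex Multiplication and Modular Functions*, §18.1.
* [Rotman1995] J. J. Rotman, *An Introduction to the Theory of Groups*, 4th ed., GTM 148, Thm. 7.41 (Schur–Zassenhaus).
-/

set_option autoImplicit false

noncomputable section

open scoped BigOperators
open NumberField NumberField.ComplexEmbedding Module IntermediateField

namespace Literature.NumberTheory.ComplexMultiplication

open Literature.AlgebraicGeometry.Motives (CMType)
open Literature.AlgebraicGeometry.Pohlmann1968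

/-! ### Signature defect zero ⟺ balanced fibres -/

section Quadratic

variable {k : Type} [Field k] [NumberField k] [IsTotallyComplex k] {K : Type} [Field K] [NumberField K]

omit [NumberField k] in
/-- No embedding of a totally complex field is real. [folklore] -/
private theorem conjugate_ne_self₆ (ι : k →+* ℂ) : conjugate ι ≠ ι := fun h =>
  IsTotallyComplex.complexEmbedding_not_isReal ι (ComplexEmbedding.isReal_iff.2 h)

/-- An imaginary quadratic field has exactly the two embeddings `ι₀`, `ῑ₀`. [cite: Shimura1998, §18.1] -/
private theorem eq_or_eq_conjugate₆ (hk : finrank ℚ k = 2) (ι₀ t : k →+* ℂ) : t = ι₀ ∨ t = conjugate ι₀ := by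
  classical
  by_contra h
  push Not at h
  have hle : ({ι₀, conjugate ι₀, t} : Finset (k →+* ℂ)).card ≤ 2 := by
    rw [← hk, ← Embeddings.card k ℂ]
    exact Finset.card_le_univ _
  have h3 : ({ι₀, conjugate ι₀, t} : Finset (k →+* ℂ)).card = 3 := by
    rw [Finset.card_insert_of_notMem, Finset.card_pair fun h' => h.2 h'.symm]
    simp only [Finset.mem_insert, Finset.mem_singleton, not_or]
    exact ⟨(conjugate_ne_self₆ ι₀).symm, fun h' => h.1 h'.symm⟩
  omega

omit [NumberField k] [IsTotallyComplex k] in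
open scoped Classical in
/-- `φ ↦ φ̄` is a bijection from the extensions of `τ` outside `Φ` onto the extensions of `τ̄` inside `Φ`.
[cite: Shimura1998, §18.1] -/
private theorem card_filter_comp_eq_and_not_mem (j : k →+* K) (Φ : CMType K) (τ : k →+* ℂ) :
    (Finset.univ.filter fun φ : K →+* ℂ => φ.comp j = τ ∧ φ ∉ Φ.1).card =
      (Finset.univ.filter fun φ : K →+* ℂ => φ.comp j = conjugate τ ∧ φ ∈ Φ.1).card := by
  refine Finset.card_nbij' (fun φ => conjugate φ) (fun φ => conjugate φ) ?_ ?_ ?_ ?_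
  · intro φ hφ
    simp only [Finset.mem_coe, Finset.mem_filter, Finset.mem_univ, true_and] at hφ ⊢
    refine ⟨RingHom.ext fun x => ?_, ?_⟩
    · rw [RingHom.comp_apply, conjugate_coe_eq, conjugate_coe_eq, ← hφ.1, RingHom.comp_apply]
    · by_contra h'
      exact hφ.2 ((Φ.2 φ).2 h')
  · intro φ hφ
    simp only [Finset.mem_coe, Finset.mem_filter, Finset.mem_univ, true_and] at hφ ⊢
    refine ⟨RingHom.ext fun x => ?_, (Φ.2 φ).1 hφ.2⟩
    rw [RingHom.comp_apply, conjugate_coe_eq, ← RingHom.comp_apply φ j, hφ.1, conjugate_coe_eq, Complex.conj_conj]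
  · intro φ _
    exact ComplexEmbedding.involutive_conjugate K φ
  · intro φ _
    exact ComplexEmbedding.involutive_conjugate K φ

open scoped Classical in
/-- **Signature defect zero ⟹ the type is balanced over `k`**: if `Σ_{φ ∈ Φ} sign(φ|_k) = 0` (as many elements of `Φ`
over `ι₀` as over `ῑ₀`) then over EACH embedding `τ` of the imaginary quadratic field `k` the type `Φ` contains as many
extensions of `τ` as it omits (`(A, k)` is of Weil type). [cite: Deligne1982HodgeCycles, §4] [cite: Gordon1999HodgeAVSurvey, 9.4.3] -/
theorem fibres_balanced_of_sum_ksign_eq_zero (hk : finrank ℚ k = 2) (ι₀ : k →+* ℂ) (j : k →+* K) (Φ : CMType K)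
    (hd : ∑ φ ∈ Finset.univ.filter (fun φ : K →+* ℂ => φ ∈ Φ.1), (if φ.comp j = ι₀ then (1 : ℚ) else -1) = 0)
    (τ : k →+* ℂ) :
    {φ : K →+* ℂ | φ.comp j = τ ∧ φ ∈ Φ.1}.ncard = {φ : K →+* ℂ | φ.comp j = τ ∧ φ ∉ Φ.1}.ncard := by
  rw [sum_ksign_eq_card_sub_card, sub_eq_zero, Nat.cast_inj] at hd
  have hAB : (Finset.univ.filter fun φ : K →+* ℂ => φ.comp j = ι₀ ∧ φ ∈ Φ.1).card =
      (Finset.univ.filter fun φ : K →+* ℂ => φ.comp j = conjugate ι₀ ∧ φ ∈ Φ.1).card := by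
    have e1 : (Finset.univ.filter fun φ : K →+* ℂ => φ.comp j = ι₀ ∧ φ ∈ Φ.1) =
        Finset.univ.filter fun φ : K →+* ℂ => φ ∈ Φ.1 ∧ φ.comp j = ι₀ :=
      Finset.filter_congr fun φ _ => and_comm
    have e2 : (Finset.univ.filter fun φ : K →+* ℂ => φ.comp j = conjugate ι₀ ∧ φ ∈ Φ.1) =
        Finset.univ.filter fun φ : K →+* ℂ => φ ∈ Φ.1 ∧ ¬ φ.comp j = ι₀ := by
      refine Finset.filter_congr fun φ _ => ?_
      rw [and_comm]
      refine and_congr_right fun _ => ⟨fun h h' => conjugate_ne_self₆ ι₀ (h.symm.trans h'), fun h => ?_⟩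
      exact (eq_or_eq_conjugate₆ hk ι₀ (φ.comp j)).resolve_left h
    rw [e1, e2]
    exact hd
  rw [← Finset.coe_filter_univ, ← Finset.coe_filter_univ, Set.ncard_coe_finset, Set.ncard_coe_finset,
    card_filter_comp_eq_and_not_mem j Φ τ]
  rcases eq_or_eq_conjugate₆ hk ι₀ τ with rfl | rfl
  · exact hAB
  · rw [show conjugate (conjugate ι₀) = ι₀ from ComplexEmbedding.involutive_conjugate k ι₀]
    exact hAB.symm

open scoped Classical in
/-- **Signature defect zero ⟹ the type is DEGENERATE** (Yanai: a CM type balanced over a subfield with a complex place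
has `Rank ≤ n`; for an imaginary quadratic `k` this is the Weil-type case). [cite: Gordon1999HodgeAVSurvey, 9.4.3]
[cite: Deligne1982HodgeCycles, §4] -/
theorem not_isNondegenerate_of_sum_ksign_eq_zero [IsCMField K] (hk : finrank ℚ k = 2) (ι₀ : k →+* ℂ) (j : k →+* K)
    (Φ : CMType K)
    (hd : ∑ φ ∈ Finset.univ.filter (fun φ : K →+* ℂ => φ ∈ Φ.1), (if φ.comp j = ι₀ then (1 : ℚ) else -1) = 0) :
    ¬ IsNondegenerate Φ :=
  not_isNondegenerate_of_fibres_balanced j (fibres_balanced_of_sum_ksign_eq_zero hk ι₀ j Φ hd) (conjugate_ne_self₆ ι₀)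

end Quadratic

/-! ### Two CM fields through a common imaginary quadratic field -/

section Family

variable {I : Type} {K : I → Type} [∀ i, Field (K i)] [∀ i, NumberField (K i)] [∀ i, IsCMField (K i)] [Fintype I]
variable {k : Type} [Field k] [NumberField k] [IsTotallyComplex k]

open scoped Classical in
/-- **Two CM fields sharing an imaginary quadratic field: EVERY family of CM types is degenerate.**  Let `k` be imaginary
quadratic with embeddings `j₀ : k → K_{i₀}`, `j₁ : k → K_{i₁}` (`i₀ ≠ i₁`).  Then `¬ IsNondegenerateFamily Φ` for every
family `Φ` of CM types of the `K_i` — no degree or signature hypothesis: if both `k`-signature defects are non-zero the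
rank is not additive (`SharedImaginaryQuadraticDegenerate`); if one vanishes, that member is balanced over `k`, hence
degenerate (Yanai), and so is the family (7.6.1).  (`rank MT(A₀ × A₁) < dim A₀ + dim A₁ + 1` for all CM abelian varieties
`A₀`, `A₁` whose CM fields both contain `k`.) [cite: Gordon1999HodgeAVSurvey, 7.5–7.7, 7.6.1 and 9.4.3]
[cite: Deligne1982HodgeCycles, §4] -/
theorem not_isNondegenerateFamily_of_shared_imaginary_quadratic (hk : finrank ℚ k = 2) {i₀ i₁ : I} (h01 : i₀ ≠ i₁)
    (j₀ : k →+* K i₀) (j₁ : k →+* K i₁) (Φ : ∀ i, CMType (K i)) : ¬ CMAlgebra.IsNondegenerateFamily Φ := by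
  haveI : Nonempty I := ⟨i₀⟩
  intro hnd
  obtain ⟨ι₀⟩ : Nonempty (k →+* ℂ) := inferInstance
  by_cases hd₀ : ∑ φ ∈ Finset.univ.filter (fun φ : K i₀ →+* ℂ => φ ∈ (Φ i₀).1),
      (if φ.comp j₀ = ι₀ then (1 : ℚ) else -1) = 0
  · exact not_isNondegenerate_of_sum_ksign_eq_zero hk ι₀ j₀ (Φ i₀) hd₀ (hnd.isNondegenerate i₀)
  by_cases hd₁ : ∑ φ ∈ Finset.univ.filter (fun φ : K i₁ →+* ℂ => φ ∈ (Φ i₁).1),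
      (if φ.comp j₁ = ι₀ then (1 : ℚ) else -1) = 0
  · exact not_isNondegenerate_of_sum_ksign_eq_zero hk ι₀ j₁ (Φ i₁) hd₁ (hnd.isNondegenerate i₁)
  exact not_isNondegenerateFamily_of_shared_quadratic hk ι₀ h01 j₀ j₁ Φ hd₀ hd₁ hnd

end Family

/-! ### Galois-closure forms: an imaginary quadratic field inside `L₀ ∩ L₁` -/

section Closure

variable {I : Type} {K : I → Type} [∀ i, Field (K i)] [∀ i, NumberField (K i)] [∀ i, IsCMField (K i)]

omit [∀ i, IsCMField (K i)] in
/-- An embedding `k → K_i` of a subfield `k ≤ L_i = ι_i(K_i)` (`K_i` Galois). [folklore] -/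
private theorem nonempty_ringHom_of_le_normalClosure₆ (i : I) [IsGalois ℚ (K i)] {k : IntermediateField ℚ ℂ}
    (hk : k ≤ normalClosure ℚ (K i) ℂ) : Nonempty (↥k →+* K i) := by
  obtain ⟨s⟩ : Nonempty (K i →+* ℂ) := inferInstance
  have hk' : k ≤ s.toRatAlgHom.fieldRange := by rwa [← normalClosure_eq_fieldRange_of_normal s.toRatAlgHom]
  have hk'' : ∀ x : ℂ, x ∈ k → x ∈ s.toRatAlgHom.range := fun x hx =>
    (AlgHom.mem_range _).2 (AlgHom.mem_fieldRange.1 (hk' hx))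
  let incl : ↥k →+* ↥s.toRatAlgHom.range :=
    { toFun := fun x => ⟨x.1, hk'' x.1 x.2⟩
      map_one' := rfl
      map_mul' := fun _ _ => rfl
      map_zero' := rfl
      map_add' := fun _ _ => rfl }
  exact ⟨(AlgEquiv.ofInjectiveField s.toRatAlgHom).symm.toRingEquiv.toRingHom.comp incl⟩

/-- A finite-dimensional subfield of `ℂ` is finite over `ℚ` when contained in a finite one. [folklore] -/
private theorem finiteDimensional_of_le₆ {E E' : IntermediateField ℚ ℂ} [FiniteDimensional ℚ E] (h : E' ≤ E) :
    FiniteDimensional ℚ E' :=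
  FiniteDimensional.of_injective (IntermediateField.inclusion h).toLinearMap (IntermediateField.inclusion_injective h)

/-- A quadratic subfield of `ℂ` moved by conjugation is totally complex. [cite: Shimura1998, §18.1] -/
private theorem isTotallyComplex_of_exists_conj_ne₆ {k : IntermediateField ℚ ℂ} [NumberField ↥k]
    (hk2 : finrank ℚ ↥k = 2) (hkx : ∃ x ∈ k, starRingEnd ℂ x ≠ x) : IsTotallyComplex ↥k := by
  obtain ⟨x, hxk, hxne⟩ := hkx
  refine isTotallyComplex_of_finrank_eq_two_of_conjugate_ne hk2 (algebraMap ↥k ℂ) fun h => ?_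
  have := RingHom.congr_fun h ⟨x, hxk⟩
  rw [ComplexEmbedding.conjugate_coe_eq] at this
  exact hxne this

omit [∀ i, IsCMField (K i)] in
/-- **No partial conjugation at a slot whose Galois closure meets another one in a field moved by conjugation**: a
partial conjugation `σ` at `i₀` is conjugation on `L_{i₀}` and the identity on `L_{i₁}`, so conjugation fixes
`L_{i₀} ∩ L_{i₁}` pointwise (`conj_apply_eq_of_exists_partialConj`). [cite: Gordon1999HodgeAVSurvey, §3 Theorem (proof)] -/
theorem not_exists_partialConj_of_mem_inf_of_conj_ne {i₀ i₁ : I} (h01 : i₀ ≠ i₁) {x : ℂ}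
    (h₀ : x ∈ normalClosure ℚ (K i₀) ℂ) (h₁ : x ∈ normalClosure ℚ (K i₁) ℂ) (hx : starRingEnd ℂ x ≠ x) :
    ¬ ∃ σ : ℂ ≃+* ℂ, (∀ s : K i₀ →+* ℂ, σ • s = (starRingAut : ℂ ≃+* ℂ) • s) ∧
      ∀ j, j ≠ i₀ → ∀ s : K j →+* ℂ, σ • s = s := by
  rintro ⟨σ, hσ, hσ'⟩
  refine hx (conj_apply_eq_of_exists_partialConj i₀ hσ hσ' h₀ ?_)
  exact (le_iSup (fun j : {j : I // j ≠ i₀} => normalClosure ℚ (K j.1) ℂ) ⟨i₁, h01.symm⟩) h₁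

variable [Fintype I]

/-- **An imaginary quadratic field inside `L₀ ∩ L₁` ⟹ every family degenerate** (`K_{i₀}`, `K_{i₁}` Galois CM fields,
no degree hypothesis): a quadratic `k ≤ L₀ ∩ L₁` with some `x ∈ k`, `x̄ ≠ x`, embeds into both `K_i` through
`L_i = ι_i(K_i)`. [cite: Gordon1999HodgeAVSurvey, 7.5–7.7, 7.6.1 and 9.4.3] -/
theorem not_isNondegenerateFamily_of_quadratic_le_inf' {i₀ i₁ : I} (h01 : i₀ ≠ i₁) [IsGalois ℚ (K i₀)]
    [IsGalois ℚ (K i₁)] {k : IntermediateField ℚ ℂ} (hk : k ≤ normalClosure ℚ (K i₀) ℂ ⊓ normalClosure ℚ (K i₁) ℂ)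
    (hk2 : finrank ℚ ↥k = 2) (hkx : ∃ x ∈ k, starRingEnd ℂ x ≠ x) (Φ : ∀ i, CMType (K i)) :
    ¬ CMAlgebra.IsNondegenerateFamily Φ := by
  haveI : FiniteDimensional ℚ ↥k := finiteDimensional_of_le₆ (hk.trans inf_le_left)
  haveI : NumberField ↥k := NumberField.mk
  haveI : IsTotallyComplex ↥k := isTotallyComplex_of_exists_conj_ne₆ hk2 hkx
  obtain ⟨j₀⟩ := nonempty_ringHom_of_le_normalClosure₆ (K := K) i₀ (hk.trans inf_le_left)
  obtain ⟨j₁⟩ := nonempty_ringHom_of_le_normalClosure₆ (K := K) i₁ (hk.trans inf_le_right)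
  exact not_isNondegenerateFamily_of_shared_imaginary_quadratic hk2 h01 j₀ j₁ Φ

omit [∀ i, IsCMField (K i)] [Fintype I] in
/-- **An imaginary quadratic field inside `L₀ ∩ L₁` ⟹ no partial conjugations** (at either slot).
[cite: Gordon1999HodgeAVSurvey, §3 Theorem (proof)] -/
theorem not_forall_exists_partialConj_of_quadratic_le_inf' {i₀ i₁ : I} (h01 : i₀ ≠ i₁)
    {k : IntermediateField ℚ ℂ} (hk : k ≤ normalClosure ℚ (K i₀) ℂ ⊓ normalClosure ℚ (K i₁) ℂ)
    (hkx : ∃ x ∈ k, starRingEnd ℂ x ≠ x) :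
    ¬ ∀ i : I, ∃ σ : ℂ ≃+* ℂ, (∀ s : K i →+* ℂ, σ • s = (starRingAut : ℂ ≃+* ℂ) • s) ∧
      ∀ j, j ≠ i → ∀ s : K j →+* ℂ, σ • s = s := fun hconj => by
  obtain ⟨x, hxk, hxne⟩ := hkx
  exact not_exists_partialConj_of_mem_inf_of_conj_ne h01 (IntermediateField.mem_inf.1 (hk hxk)).1
    (IntermediateField.mem_inf.1 (hk hxk)).2 hxne (hconj i₀)

/-- **One Galois CM field of degree `≡ 2 (mod 4)` suffices: `[L₀ ∩ L₁ : ℚ]` even ⟹ EVERY family degenerate.**  For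
`K_{i₁}` Galois CM of degree `2m₁`, `m₁` odd, and `K_{i₀}` ANY Galois CM field: if `[L₀ ∩ L₁ : ℚ]` is even then
`L₀ ∩ L₁` contains an imaginary quadratic field (`GaloisCMFieldsTwiceOddDegreePair`, Schur–Zassenhaus), so every family of
CM types of the `K_i` is degenerate. [cite: Gordon1999HodgeAVSurvey, 7.5–7.7, 7.6.1 and 9.4.3] [cite: Rotman1995, Thm. 7.41] -/
theorem not_isNondegenerateFamily_of_even_finrank_inf {m₁ : ℕ} (hm₁ : Odd m₁) {i₀ i₁ : I} (h01 : i₀ ≠ i₁)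
    [IsGalois ℚ (K i₀)] [IsGalois ℚ (K i₁)] (h₁ : finrank ℚ (K i₁) = 2 * m₁)
    (hev : Even (finrank ℚ ↥(normalClosure ℚ (K i₀) ℂ ⊓ normalClosure ℚ (K i₁) ℂ))) (Φ : ∀ i, CMType (K i)) :
    ¬ CMAlgebra.IsNondegenerateFamily Φ := by
  obtain ⟨k, hkM, hk2, hkx⟩ := exists_quadratic_le_inf_of_even_finrank_inf (i₀ := i₀) hm₁ h₁ hev
  exact not_isNondegenerateFamily_of_quadratic_le_inf' h01 hkM hk2 hkx Φ

omit [Fintype I] in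
/-- **`[L₀ ∩ L₁ : ℚ]` even ⟹ no partial conjugations** (`K_{i₁}` Galois CM of degree `2m₁`, `m₁` odd; `K_{i₀}` any CM
field). [cite: Gordon1999HodgeAVSurvey, §3 Theorem (proof)] [cite: Rotman1995, Thm. 7.41] -/
theorem not_forall_exists_partialConj_of_even_finrank_inf {m₁ : ℕ} (hm₁ : Odd m₁) {i₀ i₁ : I} (h01 : i₀ ≠ i₁)
    [IsGalois ℚ (K i₁)] (h₁ : finrank ℚ (K i₁) = 2 * m₁)
    (hev : Even (finrank ℚ ↥(normalClosure ℚ (K i₀) ℂ ⊓ normalClosure ℚ (K i₁) ℂ))) :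
    ¬ ∀ i : I, ∃ σ : ℂ ≃+* ℂ, (∀ s : K i →+* ℂ, σ • s = (starRingAut : ℂ ≃+* ℂ) • s) ∧
      ∀ j, j ≠ i → ∀ s : K j →+* ℂ, σ • s = s := by
  obtain ⟨k, hkM, -, hkx⟩ := exists_quadratic_le_inf_of_even_finrank_inf (i₀ := i₀) hm₁ h₁ hev
  exact not_forall_exists_partialConj_of_quadratic_le_inf' h01 hkM hkx

/-- **The parity dichotomy with ONE field of degree `≡ 2 (mod 4)`.**  `K_{i₁}` Galois CM of degree `2m₁`, `m₁` odd;
`K_{i₀}` ANY Galois CM field: EITHER `[L₀ ∩ L₁ : ℚ]` is odd and both slots carry partial conjugations (additive rank;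
`B• = D•` and the Hodge conjecture on every `A₀^a × A₁^b` for nondegenerate types), OR it is even and every family of CM
types is degenerate. [cite: Gordon1999HodgeAVSurvey, §3 Theorem, 7.5–7.7 and 9.4.3] [cite: Rotman1995, Thm. 7.41] -/
theorem forall_exists_partialConj_pair_or_not_isNondegenerateFamily_of_twice_odd' {m₁ : ℕ} (hm₁ : Odd m₁)
    {i₀ i₁ : I} (h01 : i₀ ≠ i₁) (hI : ∀ j, j = i₀ ∨ j = i₁) [IsGalois ℚ (K i₀)] [IsGalois ℚ (K i₁)]
    (h₁ : finrank ℚ (K i₁) = 2 * m₁) :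
    (Odd (finrank ℚ ↥(normalClosure ℚ (K i₀) ℂ ⊓ normalClosure ℚ (K i₁) ℂ)) ∧
      ∀ i : I, ∃ σ : ℂ ≃+* ℂ, (∀ s : K i →+* ℂ, σ • s = (starRingAut : ℂ ≃+* ℂ) • s) ∧
        ∀ j, j ≠ i → ∀ s : K j →+* ℂ, σ • s = s) ∨
      (Even (finrank ℚ ↥(normalClosure ℚ (K i₀) ℂ ⊓ normalClosure ℚ (K i₁) ℂ)) ∧
        ∀ Φ : ∀ i, CMType (K i), ¬ CMAlgebra.IsNondegenerateFamily Φ) := by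
  rcases Nat.even_or_odd (finrank ℚ ↥(normalClosure ℚ (K i₀) ℂ ⊓ normalClosure ℚ (K i₁) ℂ)) with hev | hodd
  · exact Or.inr ⟨hev, fun Φ => not_isNondegenerateFamily_of_even_finrank_inf hm₁ h01 h₁ hev Φ⟩
  · exact Or.inl ⟨hodd, forall_exists_partialConj_pair_of_odd_finrank h01 hI hodd⟩

omit [Fintype I] in
/-- **Partial conjugations exist iff `[L₀ ∩ L₁ : ℚ]` is odd** (`K_{i₁}` Galois CM of degree `2m₁`, `m₁` odd, `K_{i₀}`
any CM field; two slots). [cite: Gordon1999HodgeAVSurvey, §3 Theorem (proof)] [cite: Rotman1995, Thm. 7.41] -/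
theorem forall_exists_partialConj_iff_odd_finrank_inf [Finite I] {m₁ : ℕ} (hm₁ : Odd m₁) {i₀ i₁ : I}
    (h01 : i₀ ≠ i₁) (hI : ∀ j, j = i₀ ∨ j = i₁) [IsGalois ℚ (K i₁)] (h₁ : finrank ℚ (K i₁) = 2 * m₁) :
    (∀ i : I, ∃ σ : ℂ ≃+* ℂ, (∀ s : K i →+* ℂ, σ • s = (starRingAut : ℂ ≃+* ℂ) • s) ∧
        ∀ j, j ≠ i → ∀ s : K j →+* ℂ, σ • s = s) ↔
      Odd (finrank ℚ ↥(normalClosure ℚ (K i₀) ℂ ⊓ normalClosure ℚ (K i₁) ℂ)) := by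
  refine ⟨fun hconj => ?_, fun hodd => forall_exists_partialConj_pair_of_odd_finrank h01 hI hodd⟩
  rcases Nat.even_or_odd (finrank ℚ ↥(normalClosure ℚ (K i₀) ℂ ⊓ normalClosure ℚ (K i₁) ℂ)) with hev | hodd
  · exact absurd hconj (not_forall_exists_partialConj_of_even_finrank_inf hm₁ h01 h₁ hev)
  · exact hodd

end Closure

end Literature.NumberTheory.ComplexMultiplication

end
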